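import Literature.AlgebraicGeometry.Motives.AlgPointsProductProofs
import Literature.AlgebraicGeometry.Motives.ProjectiveSpaceRingPoints
import Literature.NumberTheory.Transcendental.Analytification
import Mathlib.Analysis.Calculus.FDeriv.Mul
import Mathlib.Analysis.Calculus.Deriv.Inv
import Mathlib.RingTheory.Nilpotent.Lemmas
import HarnessLib

/-!
# Holomorphic families of complex points through `Spec` of a ring of holomorphic functions

Sibling of `Literature/AlgebraicGeometry/Motives/AlgPointsProductProofs.lean`, whose device
`AlgPoints.continuous_of_family` (families of `L`-points `ρ : S → Z(L)` that factor through a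
morphism `τ : Spec C(S, L) ⟶ Z`, `ρ s = τ ∘ Spec (ev_s)`, are continuous for the strong topology)
is here run with an ARBITRARY commutative ring `R` equipped with evaluation homomorphisms
`e s : R →+* L` (`s ∈ S`) in place of `C(S, L)`:

* `AlgPoints.exists_eval_eq_div_of_family` — **local fraction representation**: if
  `ρ s = τ ∘ Spec (e s)` for all `s` and `g` is a regular function on an open `W ∋ ρ(s₀)`, then
  there are `a, c ∈ R` and `n` with `c(s₀) ≠ 0` such that `ρ(s) ∈ W(L)` and
  `g(ρ s) = a(s) / c(s)ⁿ` whenever `c(s) ≠ 0` (writing `r(s) := e s r`). Proof as in the sibling: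
  a basic open `D(c) ∋ 𝔪_{s₀}` of `Spec R` inside `τ⁻¹ W`, `τ^* g|_{D(c)} = a / cⁿ`
  (`IsLocalization.Away`), and evaluation at `s` is pull-back along `Spec (e s)`.

Taking for `R` the ring `holFun U` of (restrictions to `U` of) functions holomorphic on an open
subset `U` of a complex normed space `P` (`e x` = evaluation at `x ∈ U`), a map
`ρ : P → Z(ℂ)` interpolated on `U` by `τ : Spec (holFun U) ⟶ Z` has:

* `AlgPoints.isOpen_inter_preimage_of_holFamily`, `AlgPoints.differentiableOn_evalOrZero_of_holFamily`
  — for every open `W ⊆ Z` and `g ∈ Γ(Z, W)`, the set `U ∩ ρ⁻¹(W(ℂ))` is open and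
  `x ↦ g(ρ x)` is HOLOMORPHIC on it (locally `a / cⁿ` with `a, c` holomorphic, `c ≠ 0`);
* `AlgPoints.continuousOn_of_holFamily` — `ρ` is continuous on `U` for the strong topology.

This is the analytic counterpart of Serre's Lemme 1 c) of GAGA §2 n°5 ("toute fonction régulière
est holomorphe"), in the form needed to show that a holomorphically parametrised map into `Z(ℂ)`
— e.g. the uniformisation `ℂ → E(ℂ)`, `z ↦ [℘(z), ℘'(z)/2, 1]` of a complex elliptic curve — pulls
regular functions back to holomorphic ones (`Literature.NumberTheory.Transcendental.IsAnalytification`).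
Everything is proved; no named facts.

## References

* J.-P. Serre, *Géométrie algébrique et géométrie analytique*, Ann. Inst. Fourier 6 (1956), §2
  n°5 Lemme 1. [SerreGAGA1956]
* B. Conrad, *Weil and Grothendieck approaches to adelic points*, Enseign. Math. 58 (2012),
  Prop. 2.1, Prop. 3.1 (the basic-open/localisation step). [ConradAdelicPoints2012]
* R. Hartshorne, *Algebraic Geometry* (1977), II Prop. 2.2 (b), II Ex. 2.7.
-/

noncomputable section

universe u

open CategoryTheory AlgebraicGeometry Topology

namespace Literature.AlgebraicGeometry.Motives

namespace AlgPoints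

/-! ### Families through `Spec R` for a ring `R` with evaluation homomorphisms -/

section Family

variable {k : Type u} [Field k] {Z : SchemeOver k} {L : Type u} [Field L] [Algebra k L]
  {R : Type u} [CommRing R] {S : Type*} (e : S → (R →+* L))

variable (L) in
/-- The `L`-rational point `𝔪_s = ker (e s)` of `Spec R` attached to `s ∈ S`: the image of the
closed point under `Spec (e s) : Spec L ⟶ Spec R`. [folklore] -/
def famPt (s : S) : Spec (.of R) :=
  Spec.map (CommRingCat.ofHom (e s)) (IsLocalRing.closedPoint L)

/-- `𝔪_s ∈ D(c) ↔ c(s) ≠ 0`, for `c ∈ R = Γ(Spec R, ⊤)`. [folklore] -/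
theorem famPt_mem_basicOpen_iff (c : Γ(Spec (.of R), ⊤)) (s : S) :
    famPt L e s ∈ (Spec (.of R)).basicOpen c ↔ e s ((Scheme.ΓSpecIso (.of R)).hom c) ≠ 0 := by
  rw [basicOpen_eq_of_affine']
  change PrimeSpectrum.comap (e s) (IsLocalRing.closedPoint L) ∈
      PrimeSpectrum.basicOpen ((Scheme.ΓSpecIso (.of R)).hom c) ↔ _
  rw [PrimeSpectrum.mem_basicOpen, PrimeSpectrum.comap_asIdeal, Ideal.mem_comap,
      IsLocalRing.closedPoint, IsLocalRing.mem_maximalIdeal, mem_nonunits_iff, not_not,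
      isUnit_iff_ne_zero]

/-- Evaluation at `s` of sections of `Spec R` over a basic open `D(c) ∋ 𝔪_s`:
`Γ(Spec R, D(c)) ⟶ Γ(Spec L, ⊤) = L`, pull-back along `Spec (e s)`. [folklore] -/
def famEval (c : Γ(Spec (.of R), ⊤)) (s : S) (hs : famPt L e s ∈ (Spec (.of R)).basicOpen c) :
    Γ(Spec (.of R), (Spec (.of R)).basicOpen c) ⟶ CommRingCat.of L :=
  (Spec.map (CommRingCat.ofHom (e s))).appLE ((Spec (.of R)).basicOpen c) ⊤
      (Scheme.preimage_eq_top_of_closedPoint_mem (Spec.map (CommRingCat.ofHom (e s))) hs).ge ≫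
    (Scheme.ΓSpecIso (.of L)).hom

/-- On sections `t|_{D(c)}` coming from `t ∈ R`, `famEval c s` is `t ↦ t(s)`. [folklore] -/
theorem famEval_algebraMap (c t : Γ(Spec (.of R), ⊤)) (s : S)
    (hs : famPt L e s ∈ (Spec (.of R)).basicOpen c) :
    famEval e c s hs (algebraMap _ _ t) = e s ((Scheme.ΓSpecIso (.of R)).hom t) := by
  rw [famEval, CommRingCat.comp_apply, ΓSpecIso_appLE_algebraMap]
  rfl

variable (τ : Spec (.of R) ⟶ Z.left) (ρ : S → AlgPoints Z L)
  (hρ : ∀ s, Spec.map (CommRingCat.ofHom (e s)) ≫ τ = (ρ s).toSpecHom)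

include hρ in
/-- If `ρ s = τ ∘ Spec (e s)`, then `τ (𝔪_s)` is the point of `Z` underlying `ρ s`. [folklore] -/
theorem apply_famPt (s : S) : τ (famPt L e s) = (ρ s).pt := by
  change _ = (ρ s).toSpecHom (IsLocalRing.closedPoint L)
  rw [← hρ s, Scheme.Hom.comp_apply]
  rfl

include hρ in
/-- If `ρ s = τ ∘ Spec (e s)` and `D(c) ⊆ τ⁻¹ W` contains `𝔪_s`, then for `g ∈ Γ(Z, W)` the value
`g(ρ s)` is the evaluation at `s` of the pulled-back section `τ^* g ∈ Γ(Spec R, D(c))`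
(Mathlib `Scheme.Hom.appLE_comp_appLE`). [folklore] -/
theorem eval_eq_famEval (W : Z.left.Opens) (g : Γ(Z.left, W)) (c : Γ(Spec (.of R), ⊤))
    (hcW : (Spec (.of R)).basicOpen c ≤ τ ⁻¹ᵁ W) (s : S)
    (hs : famPt L e s ∈ (Spec (.of R)).basicOpen c) :
    ∃ hW : (ρ s).pt ∈ W, (ρ s).eval W hW g =
      famEval e c s hs (τ.appLE W ((Spec (.of R)).basicOpen c) hcW g) := by
  have hW' : τ (famPt L e s) ∈ W := hcW hs
  have hW : (ρ s).pt ∈ W := by rw [← apply_famPt e τ ρ hρ s]; exact hW'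
  refine ⟨hW, ?_⟩
  have e' : ⊤ ≤ (Spec.map (CommRingCat.ofHom (e s)) ≫ τ) ⁻¹ᵁ W :=
    (Scheme.preimage_eq_top_of_closedPoint_mem (Spec.map (CommRingCat.ofHom (e s)) ≫ τ)
      (U := W) (by rw [Scheme.Hom.comp_apply]; exact hW')).ge
  rw [eval_eq_appLE_of_eq (ρ s) W hW g _ (hρ s) e',
    ← Scheme.Hom.appLE_comp_appLE _ τ W ((Spec (.of R)).basicOpen c) ⊤ hcW
      (Scheme.preimage_eq_top_of_closedPoint_mem (Spec.map (CommRingCat.ofHom (e s))) hs).ge,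
    CategoryTheory.comp_apply, famEval, CategoryTheory.comp_apply]

include hρ in
/-- **Local fraction representation of regular functions along a family through `Spec R`.**
Let `e s : R →+* L` (`s ∈ S`) be ring homomorphisms ("evaluation at `s`"), `τ : Spec R ⟶ Z` a
morphism of schemes and `ρ : S → Z(L)` with `ρ s = τ ∘ Spec (e s)` for all `s`. For a regular
function `g` on an open `W ⊆ Z` and `s₀` with `ρ(s₀) ∈ W(L)` there are `a, c ∈ R` and `n ∈ ℕ` with
`c(s₀) ≠ 0` such that, whenever `c(s) ≠ 0`, `ρ(s) ∈ W(L)` and `g(ρ s) = a(s) / c(s)ⁿ`: choose a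
basic open `D(c) ∋ 𝔪_{s₀}` of `Spec R` inside `τ⁻¹ W` and write `τ^* g|_{D(c)} = a / cⁿ`
(`Γ(Spec R, D(c)) = R_c`). Serre, GAGA §2 n°5 Lemme 1 c); Conrad (2012), proof of Prop. 3.1.
[cite: SerreGAGA1956, §2 n°5 Lemme 1] -/
theorem exists_eval_eq_div_of_family (W : Z.left.Opens) (g : Γ(Z.left, W)) {s₀ : S}
    (h₀ : (ρ s₀).pt ∈ W) :
    ∃ (a c : R) (n : ℕ), e s₀ c ≠ 0 ∧
      ∀ s, e s c ≠ 0 → ∃ hW : (ρ s).pt ∈ W, (ρ s).eval W hW g = e s a / e s c ^ n := by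
  have hx₀ : famPt L e s₀ ∈ τ ⁻¹ᵁ W := by
    change τ (famPt L e s₀) ∈ W
    rw [apply_famPt e τ ρ hρ]
    exact h₀
  -- a basic open `D(c) ∋ 𝔪_{s₀}` inside `τ ⁻¹ W`, and `τ^* g = a / c ^ n` on it
  obtain ⟨c, hcW, hc₀⟩ :=
    (isAffineOpen_top (Spec (.of R))).exists_basicOpen_le ⟨famPt L e s₀, hx₀⟩ trivial
  obtain ⟨⟨a, m⟩, hm⟩ := IsLocalization.surj (Submonoid.powers c)
    (τ.appLE W ((Spec (.of R)).basicOpen c) hcW g)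
  obtain ⟨n, hn⟩ := (Submonoid.mem_powers_iff _ _).mp m.2
  refine ⟨(Scheme.ΓSpecIso (.of R)).hom a, (Scheme.ΓSpecIso (.of R)).hom c, n,
    (famPt_mem_basicOpen_iff e c s₀).mp hc₀, fun s hs ↦ ?_⟩
  have hxs : famPt L e s ∈ (Spec (.of R)).basicOpen c := (famPt_mem_basicOpen_iff e c s).mpr hs
  obtain ⟨hW, he⟩ := eval_eq_famEval e τ ρ hρ W g c hcW s hxs
  refine ⟨hW, ?_⟩
  rw [he]
  have key := congrArg (fun z ↦ famEval e c s hxs z) hm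
  simp only [map_mul, ← hn, map_pow] at key
  rw [famEval_algebraMap, famEval_algebraMap] at key
  exact eq_div_of_mul_eq (pow_ne_zero n hs) key

end Family

/-! ### The ring of holomorphic functions on an open subset of a complex normed space -/

section HolFun

variable {P : Type} [NormedAddCommGroup P] [NormedSpace ℂ P]

/-- **The `ℂ`-algebra of holomorphic functions on `U`**, as functions on the subtype `U`: the
restrictions to `U` of functions `P → ℂ` that are complex differentiable on `U` (for `U` open
these are the holomorphic functions on `U`). A subalgebra of `U → ℂ`. [folklore] -/
def holFun (U : Set P) : Subalgebra ℂ (U → ℂ) where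
  carrier := {g | ∃ f : P → ℂ, DifferentiableOn ℂ f U ∧ ∀ x : U, g x = f x}
  mul_mem' := by
    rintro g g' ⟨f, hf, hgf⟩ ⟨f', hf', hgf'⟩
    exact ⟨f * f', hf.mul hf', fun x ↦ by rw [Pi.mul_apply, Pi.mul_apply, hgf, hgf']⟩
  one_mem' := ⟨fun _ ↦ 1, differentiableOn_const 1, fun _ ↦ rfl⟩
  add_mem' := by
    rintro g g' ⟨f, hf, hgf⟩ ⟨f', hf', hgf'⟩
    exact ⟨f + f', hf.add hf', fun x ↦ by rw [Pi.add_apply, Pi.add_apply, hgf, hgf']⟩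
  zero_mem' := ⟨fun _ ↦ 0, differentiableOn_const 0, fun _ ↦ rfl⟩
  algebraMap_mem' a := ⟨fun _ ↦ a, differentiableOn_const a, fun _ ↦ rfl⟩

/-- Membership in `holFun U`: `g` is the restriction of a function differentiable on `U`.
[folklore] -/
theorem mem_holFun_iff {U : Set P} (g : U → ℂ) :
    g ∈ holFun U ↔ ∃ f : P → ℂ, DifferentiableOn ℂ f U ∧ ∀ x : U, g x = f x :=
  Iff.rfl

/-- The restriction to `U` of a function differentiable on `U`, as an element of `holFun U`.
[folklore] -/
def holFun.restrict {U : Set P} (f : P → ℂ) (hf : DifferentiableOn ℂ f U) : holFun U :=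
  ⟨fun x ↦ f x, f, hf, fun _ ↦ rfl⟩

/-- Values of `holFun.restrict`. [folklore] -/
@[simp]
theorem holFun.restrict_apply {U : Set P} (f : P → ℂ) (hf : DifferentiableOn ℂ f U) (x : U) :
    (holFun.restrict f hf : U → ℂ) x = f x :=
  rfl

/-- A ring of `ℂ`-valued functions is reduced; in particular `holFun U` is. [folklore] -/
instance isReduced_holFun (U : Set P) : IsReduced (holFun U) :=
  isReduced_of_injective (holFun U).val Subtype.val_injective

/-- **Evaluation at `x ∈ U`** as a `ℂ`-algebra homomorphism `holFun U →ₐ[ℂ] ℂ`. [folklore] -/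
def holEvalₐ {U : Set P} (x : U) : holFun U →ₐ[ℂ] ℂ :=
  (Pi.evalAlgHom ℂ (fun _ : U ↦ ℂ) x).comp (holFun U).val

/-- Evaluation at `x ∈ U` as a ring homomorphism `holFun U →+* ℂ`. [folklore] -/
def holEval {U : Set P} (x : U) : holFun U →+* ℂ :=
  (holEvalₐ x).toRingHom

/-- `holEval x g = g x`. [folklore] -/
@[simp]
theorem holEval_apply {U : Set P} (x : U) (g : holFun U) : holEval x g = (g : U → ℂ) x :=
  rfl

/-- `holEvalₐ x g = g x`. [folklore] -/
@[simp]
theorem holEvalₐ_apply {U : Set P} (x : U) (g : holFun U) : holEvalₐ x g = (g : U → ℂ) x :=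
  rfl

/-- `(holEvalₐ x).toRingHom = holEval x`. [folklore] -/
theorem holEvalₐ_toRingHom {U : Set P} (x : U) : (holEvalₐ x).toRingHom = holEval x :=
  rfl

/-- Every element of `holFun U` is, on `U`, a function differentiable on `U`. [folklore] -/
theorem holFun.exists_differentiableOn {U : Set P} (g : holFun U) :
    ∃ f : P → ℂ, DifferentiableOn ℂ f U ∧ ∀ x : U, holEval x g = f x :=
  g.2

end HolFun

/-! ### Holomorphic families -/

section HolFamily

variable {P : Type} [NormedAddCommGroup P] [NormedSpace ℂ P]
  {k : Type} [Field k] [Algebra k ℂ] {Z : SchemeOver k} {U : Set P} (hU : IsOpen U)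
  (τ : Spec (.of (holFun U)) ⟶ Z.left) (ρ : P → AlgPoints Z ℂ)
  (hρ : ∀ x : U, Spec.map (CommRingCat.ofHom (holEval x)) ≫ τ = (ρ x).toSpecHom)

include hU hρ in
/-- **Regular functions are locally holomorphic fractions along a holomorphic family.** If
`ρ : P → Z(ℂ)` is interpolated on the open set `U` by `τ : Spec (holFun U) ⟶ Z`
(`ρ x = τ ∘ Spec (ev_x)` for `x ∈ U`), then near every `x₀ ∈ U` with `ρ(x₀) ∈ W(ℂ)` there is an
open `V ∋ x₀`, `V ⊆ U ∩ ρ⁻¹(W(ℂ))`, and functions `a, c` holomorphic on `U` with `c ≠ 0` on `V` and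
`g(ρ x) = a(x) / c(x)ⁿ` on `V`. [cite: SerreGAGA1956, §2 n°5 Lemme 1] -/
theorem exists_nhds_evalOrZero_eq_div_of_holFamily (W : Z.left.Opens) (g : Γ(Z.left, W)) {x₀ : P}
    (hx₀ : x₀ ∈ U) (h₀ : (ρ x₀).pt ∈ W) :
    ∃ (V : Set P) (a c : P → ℂ) (n : ℕ), IsOpen V ∧ x₀ ∈ V ∧ V ⊆ U ∩ ρ ⁻¹' {Q | Q.pt ∈ W} ∧
      DifferentiableOn ℂ a U ∧ DifferentiableOn ℂ c U ∧ (∀ x ∈ V, c x ≠ 0) ∧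
      ∀ x ∈ V, evalOrZero W g (ρ x) = a x / c x ^ n := by
  obtain ⟨a, c, n, hc₀, hrep⟩ := exists_eval_eq_div_of_family (S := U) holEval τ (fun x ↦ ρ x)
    hρ W g (s₀ := ⟨x₀, hx₀⟩) h₀
  obtain ⟨fa, hfa, hfa'⟩ := holFun.exists_differentiableOn a
  obtain ⟨fc, hfc, hfc'⟩ := holFun.exists_differentiableOn c
  refine ⟨U ∩ fc ⁻¹' {0}ᶜ, fa, fc, n, hfc.continuousOn.isOpen_inter_preimage hU isOpen_compl_singleton,
    ⟨hx₀, ?_⟩, ?_, hfa, hfc, fun x hx ↦ hx.2, fun x hx ↦ ?_⟩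
  · change fc x₀ ≠ 0
    rw [← hfc' ⟨x₀, hx₀⟩]
    exact hc₀
  · rintro x ⟨hxU, hxc⟩
    have hxc' : holEval ⟨x, hxU⟩ c ≠ 0 := by rw [hfc']; exact hxc
    obtain ⟨hW, -⟩ := hrep ⟨x, hxU⟩ hxc'
    exact ⟨hxU, hW⟩
  · have hxc' : holEval ⟨x, hx.1⟩ c ≠ 0 := by rw [hfc']; exact hx.2
    obtain ⟨hW, hval⟩ := hrep ⟨x, hx.1⟩ hxc'
    rw [evalOrZero_of_mem _ hW, hval, hfa', hfc']

include hU hρ in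
/-- **`U ∩ ρ⁻¹(W(ℂ))` is open** for a holomorphic family `ρ` on `U` and an open `W ⊆ Z`.
[cite: SerreGAGA1956, §2 n°5 Lemme 1] -/
theorem isOpen_inter_preimage_of_holFamily (W : Z.left.Opens) :
    IsOpen (U ∩ ρ ⁻¹' {Q | Q.pt ∈ W}) := by
  rw [isOpen_iff_forall_mem_open]
  rintro x₀ ⟨hx₀, h₀⟩
  obtain ⟨V, -, -, -, hV, hxV, hVsub, -⟩ :=
    exists_nhds_evalOrZero_eq_div_of_holFamily hU τ ρ hρ W (0 : Γ(Z.left, W)) hx₀ h₀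
  exact ⟨V, hVsub, hV, hxV⟩

include hU hρ in
/-- **Regular functions pull back to holomorphic functions along a holomorphic family**: for an
open `W ⊆ Z` and `g ∈ Γ(Z, W)`, `x ↦ g(ρ x)` is complex differentiable on the open set
`U ∩ ρ⁻¹(W(ℂ))` (locally a quotient `a / cⁿ` of holomorphic functions with `c ≠ 0`; Serre's
Lemme 1 c): "toute fonction régulière est holomorphe"). [cite: SerreGAGA1956, §2 n°5 Lemme 1] -/
theorem differentiableOn_evalOrZero_of_holFamily (W : Z.left.Opens) (g : Γ(Z.left, W)) :
    DifferentiableOn ℂ (fun x ↦ evalOrZero W g (ρ x)) (U ∩ ρ ⁻¹' {Q | Q.pt ∈ W}) := by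
  rintro x₀ ⟨hx₀, h₀⟩
  obtain ⟨V, a, c, n, hV, hxV, hVsub, ha, hc, hc0, hrep⟩ :=
    exists_nhds_evalOrZero_eq_div_of_holFamily hU τ ρ hρ W g hx₀ h₀
  have hVU : V ⊆ U := fun x hx ↦ (hVsub hx).1
  have hdiff : DifferentiableOn ℂ (fun x ↦ a x / c x ^ n) V := by
    simp only [div_eq_mul_inv]
    exact (ha.mono hVU).mul (((hc.mono hVU).pow n).inv fun x hx ↦ pow_ne_zero n (hc0 x hx))
  have hAt : DifferentiableAt ℂ (fun x ↦ a x / c x ^ n) x₀ :=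
    hdiff.differentiableAt (hV.mem_nhds hxV)
  refine (hAt.congr_of_eventuallyEq ?_).differentiableWithinAt
  exact Filter.eventuallyEq_of_mem (hV.mem_nhds hxV) fun x hx ↦ hrep x hx

include hU hρ in
/-- **A holomorphic family is continuous** (on `U`, for the strong topology on `Z(ℂ)`): the
sub-basic open sets `{Q ∈ W(ℂ) | g(Q) ∈ O}` pull back to `{x ∈ U ∩ ρ⁻¹(W(ℂ)) | g(ρ x) ∈ O}`, open
by the two previous results. (Also a special case of `AlgPoints.continuous_of_family`.)
[cite: SerreGAGA1956, §2 n°5 Lemme 1] -/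
theorem continuousOn_of_holFamily : ContinuousOn ρ U := by
  rw [continuousOn_iff_continuous_restrict, continuous_generateFrom_iff]
  rintro _ ⟨W, g, O, hO, rfl⟩
  have hopen : IsOpen (U ∩ ρ ⁻¹' {Q | Q.pt ∈ W} ∩ (fun x ↦ evalOrZero W g (ρ x)) ⁻¹' O) :=
    (differentiableOn_evalOrZero_of_holFamily hU τ ρ hρ W g).continuousOn.isOpen_inter_preimage
      (isOpen_inter_preimage_of_holFamily hU τ ρ hρ W) hO
  have heq : U.restrict ρ ⁻¹' basicSet W g O =
      Subtype.val ⁻¹' (U ∩ ρ ⁻¹' {Q | Q.pt ∈ W} ∩ (fun x ↦ evalOrZero W g (ρ x)) ⁻¹' O) := by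
    ext ⟨x, hx⟩
    simp only [Set.restrict_apply, Set.mem_preimage, Set.mem_inter_iff, Set.mem_setOf_eq, basicSet]
    constructor
    · rintro ⟨hW, hgO⟩
      exact ⟨⟨hx, hW⟩, by rwa [evalOrZero_of_mem _ hW]⟩
    · rintro ⟨⟨-, hW⟩, hgO⟩
      exact ⟨hW, by rwa [evalOrZero_of_mem _ hW] at hgO⟩
  rw [heq]
  exact hopen.preimage continuous_subtype_val

end HolFamily

/-! ### Holomorphic families as a predicate, and their permanence properties -/

section IsHolFamilyOn

variable {P : Type} [NormedAddCommGroup P] [NormedSpace ℂ P]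
  {P' : Type} [NormedAddCommGroup P'] [NormedSpace ℂ P']
  {X Y : SchemeOver ℂ}

/-- **`G : P → X(ℂ)` is a holomorphic family on `U`**: it is interpolated on `U` by a
`ℂ`-morphism `σ : Spec (holFun U) ⟶ X` from the spectrum of the ring of holomorphic functions on
`U`, i.e. `G x = σ ∘ Spec (ev_x)` for every `x ∈ U` (a "`holFun U`-valued point" of `X`
specialising to the `G x`). [folklore] -/
def IsHolFamilyOn (U : Set P) (G : P → AlgPoints X ℂ) : Prop :=
  ∃ σ : specOver ℂ (holFun U) ⟶ X, ∀ x : U, specOverOfAlgHom (holEvalₐ x) ≫ σ = G x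

/-- The scheme-level specialisation equations of a holomorphic family. [folklore] -/
theorem IsHolFamilyOn.specMap_comp_left {U : Set P} {G : P → AlgPoints X ℂ}
    {σ : specOver ℂ (holFun U) ⟶ X} (hσ : ∀ x : U, specOverOfAlgHom (holEvalₐ x) ≫ σ = G x)
    (x : U) : Spec.map (CommRingCat.ofHom (holEval x)) ≫ σ.left = (G x).toSpecHom := by
  exact congrArg CommaMorphism.left (hσ x)

/-- **Restriction / holomorphic reparametrisation.** The `ℂ`-algebra map `holFun U → holFun U'`,
`g ↦ g ∘ φ`, for `φ : P' → P` complex differentiable on `U'` with `φ(U') ⊆ U`. [folklore] -/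
def holFun.comap {U : Set P} {U' : Set P'} (φ : P' → P) (hφ : DifferentiableOn ℂ φ U')
    (hmaps : Set.MapsTo φ U' U) : holFun U →ₐ[ℂ] holFun U' where
  toFun g := ⟨fun x ↦ (g : U → ℂ) ⟨φ x, hmaps x.2⟩, by
    obtain ⟨f, hf, hgf⟩ := g.2
    exact ⟨f ∘ φ, hf.comp hφ hmaps, fun x ↦ hgf ⟨φ x, hmaps x.2⟩⟩⟩
  map_one' := rfl
  map_mul' _ _ := rfl
  map_zero' := rfl
  map_add' _ _ := rfl
  commutes' _ := rfl

/-- Evaluation at `x'` after `comap φ` is evaluation at `φ x'`. [folklore] -/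
theorem holEvalₐ_comp_comap {U : Set P} {U' : Set P'} (φ : P' → P) (hφ : DifferentiableOn ℂ φ U')
    (hmaps : Set.MapsTo φ U' U) (x : U') :
    (holEvalₐ x).comp (holFun.comap φ hφ hmaps) = holEvalₐ ⟨φ x, hmaps x.2⟩ :=
  AlgHom.ext fun _ ↦ rfl

/-- **Holomorphic families are stable under holomorphic reparametrisation**: if `G` is a
holomorphic family on `U` and `φ : P' → P` is complex differentiable on `U'` with `φ(U') ⊆ U`,
then `G ∘ φ` is a holomorphic family on `U'`. [folklore] -/
theorem IsHolFamilyOn.comp {U : Set P} {G : P → AlgPoints X ℂ} (h : IsHolFamilyOn U G)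
    {U' : Set P'} (φ : P' → P) (hφ : DifferentiableOn ℂ φ U') (hmaps : Set.MapsTo φ U' U) :
    IsHolFamilyOn U' (G ∘ φ) := by
  obtain ⟨σ, hσ⟩ := h
  refine ⟨specOverOfAlgHom (holFun.comap φ hφ hmaps) ≫ σ, fun x ↦ ?_⟩
  rw [← Category.assoc, ← specOverOfAlgHom_comp, holEvalₐ_comp_comap, hσ ⟨φ x, hmaps x.2⟩]
  rfl

/-- Holomorphic families restrict to smaller sets. [folklore] -/
theorem IsHolFamilyOn.mono {U U' : Set P} {G : P → AlgPoints X ℂ} (h : IsHolFamilyOn U G)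
    (hU' : U' ⊆ U) : IsHolFamilyOn U' G :=
  h.comp id differentiableOn_id fun _ hx ↦ hU' hx

/-- Holomorphic families are preserved by `ℂ`-morphisms `X ⟶ Y`. [folklore] -/
theorem IsHolFamilyOn.map {U : Set P} {G : P → AlgPoints X ℂ} (h : IsHolFamilyOn U G)
    (f : X ⟶ Y) : IsHolFamilyOn U (fun x ↦ AlgPoints.map f (G x)) := by
  obtain ⟨σ, hσ⟩ := h
  exact ⟨σ ≫ f, fun x ↦ by rw [← Category.assoc, hσ x]; rfl⟩

/-- **Pairs of holomorphic families are holomorphic families in the product**: if `G₁ : P → X(ℂ)`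
and `G₂ : P → Y(ℂ)` are holomorphic families on `U`, so is `x ↦ (G₁ x, G₂ x) ∈ (X ×_ℂ Y)(ℂ)`
(pair the interpolating morphisms, `CartesianMonoidalCategory.lift`). [folklore] -/
theorem IsHolFamilyOn.prodMk {U : Set P} {G₁ : P → AlgPoints X ℂ} {G₂ : P → AlgPoints Y ℂ}
    (h₁ : IsHolFamilyOn U G₁) (h₂ : IsHolFamilyOn U G₂) :
    IsHolFamilyOn U (fun x ↦ prodEquiv.symm (G₁ x, G₂ x)) := by
  obtain ⟨σ₁, hσ₁⟩ := h₁
  obtain ⟨σ₂, hσ₂⟩ := h₂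
  refine ⟨CartesianMonoidalCategory.lift σ₁ σ₂, fun x ↦ ?_⟩
  rw [CartesianMonoidalCategory.comp_lift, hσ₁ x, hσ₂ x]
  rfl

variable {U : Set P} (hU : IsOpen U) {G : P → AlgPoints X ℂ} (h : IsHolFamilyOn U G)
include hU h

/-- A holomorphic family on an open set is continuous there (strong topology on `X(ℂ)`).
[cite: SerreGAGA1956, §2 n°5 Lemme 1] -/
theorem IsHolFamilyOn.continuousOn : ContinuousOn G U := by
  obtain ⟨σ, hσ⟩ := h
  exact continuousOn_of_holFamily hU σ.left G (IsHolFamilyOn.specMap_comp_left hσ)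

/-- For a holomorphic family `G` on an open `U` and an open `W ⊆ X`, `U ∩ G⁻¹(W(ℂ))` is open.
[cite: SerreGAGA1956, §2 n°5 Lemme 1] -/
theorem IsHolFamilyOn.isOpen_inter_preimage (W : X.left.Opens) :
    IsOpen (U ∩ G ⁻¹' {Q | Q.pt ∈ W}) := by
  obtain ⟨σ, hσ⟩ := h
  exact isOpen_inter_preimage_of_holFamily hU σ.left G (IsHolFamilyOn.specMap_comp_left hσ) W

/-- **Regular functions pull back to holomorphic functions along a holomorphic family** on an
open set: `x ↦ g(G x)` is complex differentiable on `U ∩ G⁻¹(W(ℂ))` for every open `W ⊆ X` and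
`g ∈ Γ(X, W)`. [cite: SerreGAGA1956, §2 n°5 Lemme 1] -/
theorem IsHolFamilyOn.differentiableOn_evalOrZero (W : X.left.Opens) (g : Γ(X.left, W)) :
    DifferentiableOn ℂ (fun x ↦ evalOrZero W g (G x)) (U ∩ G ⁻¹' {Q | Q.pt ∈ W}) := by
  obtain ⟨σ, hσ⟩ := h
  exact differentiableOn_evalOrZero_of_holFamily hU σ.left G (IsHolFamilyOn.specMap_comp_left hσ)
    W g

end IsHolFamilyOn

end AlgPoints

end Literature.AlgebraicGeometry.Motives
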